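/-
Copyright (c) 2026 the pub-hodgecm-mathlib formalisation cell (harness21).  Prover seat hodgecm-mathlib-K2E3-p17 (g7), Track B «K2-LIT» ∕ h413
(`stmt-HodgeConjecture-24833`), line `K2_E3_EllipticInputs`, unit U12 §L, road «GL-[M6]-sc» (owner K2E3-p23 (g5)), RULINGS #12 (M12-5) ∕ #13 (M13-2): the COMPANION
STEP of the a.e. normal form — «a mixed regular semisimple `g ∈ GL₃` is conjugate to `leviBlock(C_π, c)`, `C_π = [[0, −N₀],[1, T]]` the companion matrix of the
irreducible quadratic factor `π = X² − T X + N₀` of `χ_g`».  2026-09-04.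
-/
import Summits.HodgeConjecture.HodgeConjecture.Theorems.K2E3GL3CharpolyDiscNullHaar   -- ★ (N0) p858121 (this seat): `normalForm_of_discr_ne_zero`, `ae_discr_charpoly_ne_zero`
import Literature.NumberTheory.Rogawski1990.UnitStableOrbitalIntegralHSideValueTypeTwo  -- ★ `UnitaryGroup.mul_cyclicFrame_eq_cyclicFrame_mul_companion` (Cayley–Hamilton in the cyclic frame; reused, not restated)
import Mathlib.LinearAlgebra.Matrix.Charpoly.Coeff                                  -- `Matrix.charpoly_fin_two`
import HarnessLib

/-!
# K2_E3 road (h413), §L — (N0) rider: the companion normal form `y · leviBlock(C_π, c) · y⁻¹` of a mixed regular semisimple element of `GL₃`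

Cell `pub/hodgecm-mathlib` (D-0151), Track B, seat K2E3-p17 (g7); road owner K2E3-p23 (g5) RULINGS #12 (M12-5) «NORMAL FORM FOR THE MIXED CARTAN: `γ = leviBlock(C_π, c)`
with `C_π = !![0, −N₀; 1, T]` the COMPANION matrix of the irreducible quadratic factor — no classification of quadratic fields, no fixed `τ`» and #13 (M13-2) «p17: land
the companion step next to (N0)».  `--supports stmt-HodgeConjecture-24833 --as helper`; THEOREMS ONLY (no definition ∕ instance ∕ notation ∕ named fact ∕ `sorry`); never
imports `Cruxes/…/Lines`; ★ (N0)'s landed declarations are untouched (this is a NEW file).  COUNT-NEUTRAL.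

THE MATHEMATICS.  §1 (`2 × 2`, any field): if `χ_A` is irreducible then `A₁₀ ≠ 0` (else `A` is upper triangular and `χ_A = (X − A₀₀)(X − A₁₁)`), and with the
cyclic basis `(e₀, A e₀)`, i.e. `y = [[1, A₀₀],[0, A₁₀]]` (`det y = A₁₀`), Cayley–Hamilton reads `A y = y C_A`, `C_A = [[0, −det A],[1, tr A]]` (★ `UnitaryGroup.mul_cyclicFrame_eq_cyclicFrame_mul_companion`, reused);
so `A = y C_A y⁻¹` and `χ_{C_A} = χ_A = X² − (tr A) X + det A`.  §2 (`3 × 3`): the same `y ⊕ 1` conjugates `leviBlock(A, c) = [[A, 0],[0, c]]` to `leviBlock(C_A, c)`.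
§3: composed with ★ (N0) `normalForm_of_discr_ne_zero`, the trichotomy reads SPLIT `y·diag(d)·y⁻¹` ∕ MIXED `y·[[0,−N₀,0],[1,T,0],[0,0,c]]·y⁻¹` with `X² − T X + N₀`
irreducible ∕ ELLIPTIC, and Haar-a.e. on `GL₃(F)` (★ (N0) `ae_discr_charpoly_ne_zero`).
[HarishChandra1970, Part VII §3 (reduction to the Cartan subgroups `A`, `T_E`)] [PlatonovRapinchuk1994, §3.3] [folklore: rational canonical form]
HONEST LABEL: HC_CM is proved only modulo the 7 printed citations (2 remaining named inputs: hLiu418 = stmt-HodgeConjecture-24832, h413 = stmt-HodgeConjecture-24833)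
until rung 0 closes; count-neutral helper.

## Mathlib ∕ tree search
Tree: ★ (N0) `K2E3GL3CharpolyDiscNullHaar.{normalForm_of_discr_ne_zero, ae_discr_charpoly_ne_zero}`, ★ B4-1d (T3) (the `leviBlock` form with an irreducible block).
★ `Literature.NumberTheory.Automorphic.UnitaryGroup.mul_cyclicFrame_eq_cyclicFrame_mul_companion` (Rogawski1990 H-side type-2 file; the dry-run dedup found it).
Mathlib: `Matrix.charpoly_fin_two`, `Matrix.charpoly_of_upperTriangular`, `Matrix.det_fin_two`, `Matrix.det_fin_three`, `Matrix.trace_fin_two`, `Matrix.charpoly_units_conj`,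
`Polynomial.not_isUnit_X_sub_C`, `Matrix.GeneralLinearGroup.mkOfDetNeZero`.  Dedup: `rg "companion|!!\[0, -.*; 1, .*trace"` over Summits∕Literature K2E3 files — the tree has
NO rational-canonical-form lemma for `2 × 2` matrices (Mathlib neither); `leviBlock` currency as in ★ B4-1d.

## References
* [HarishChandra1970] Harish-Chandra (van Dijk), *Harmonic Analysis on Reductive p-adic Groups*, LNM 162 (1970), Part VII §3.
* [PlatonovRapinchuk1994] V. Platonov, A. Rapinchuk, *Algebraic Groups and Number Theory* (1994), §3.3.
-/

set_option autoImplicit false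
set_option linter.dupNamespace false

noncomputable section

open MeasureTheory Matrix Polynomial
open scoped MatrixGroups

namespace Summit.HodgeConjecture.HodgeConjecture.Cruxes.H413.K2E3GL3MixedCompanionNormalForm

/-! ## §1  `2 × 2`: an irreducible characteristic polynomial forces the companion normal form -/

section TwoByTwo

variable {K : Type*} [Field K]

/-- If `χ_A` is irreducible (`A` a `2 × 2` matrix) then `A₁₀ ≠ 0` (else `A` is upper triangular and `χ_A = (X − A₀₀)(X − A₁₁)` is reducible). [folklore] -/
theorem apply_one_zero_ne_zero_of_irreducible (A : Matrix (Fin 2) (Fin 2) K) (hirr : Irreducible A.charpoly) : A 1 0 ≠ 0 := by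
  intro h10
  have hbt : A.BlockTriangular id := by
    intro i j hij
    fin_cases i <;> fin_cases j <;> simp at hij ⊢
    exact h10
  have hχ : A.charpoly = (X - C (A 0 0)) * (X - C (A 1 1)) := by
    rw [Matrix.charpoly_of_upperTriangular A hbt, Fin.prod_univ_two]
  rcases hirr.isUnit_or_isUnit hχ with h | h
  · exact Polynomial.not_isUnit_X_sub_C (A 0 0) h
  · exact Polynomial.not_isUnit_X_sub_C (A 1 1) h

/-- **THE COMPANION NORMAL FORM (`2 × 2`)**: if `χ_A` is irreducible there is `y ∈ GL₂(K)` with `A = y · [[0, −det A],[1, tr A]] · y⁻¹` (rational canonical form via the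
cyclic vector `e₀`). [cite: PlatonovRapinchuk1994, §3.3] -/
theorem exists_conj_companion_of_irreducible (A : Matrix (Fin 2) (Fin 2) K) (hirr : Irreducible A.charpoly) :
    ∃ y : GL (Fin 2) K, A = (y : Matrix (Fin 2) (Fin 2) K) * !![0, -A.det; 1, A.trace] * ((y⁻¹ : GL (Fin 2) K) : Matrix (Fin 2) (Fin 2) K) := by
  have h10 := apply_one_zero_ne_zero_of_irreducible A hirr
  have hdet : (!![1, A 0 0; 0, A 1 0] : Matrix (Fin 2) (Fin 2) K).det ≠ 0 := by
    rw [Matrix.det_fin_two]; simpa using h10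
  refine ⟨Matrix.GeneralLinearGroup.mkOfDetNeZero _ hdet, ?_⟩
  rw [Matrix.coe_units_inv]
  show A = !![1, A 0 0; 0, A 1 0] * !![0, -A.det; 1, A.trace] * (!![1, A 0 0; 0, A 1 0])⁻¹
  rw [← Literature.NumberTheory.Automorphic.UnitaryGroup.mul_cyclicFrame_eq_cyclicFrame_mul_companion A,
    Matrix.mul_nonsing_inv_cancel_right _ _ (by simpa [Matrix.isUnit_iff_isUnit_det, isUnit_iff_ne_zero] using hdet)]

/-- `χ_{[[0, −N₀],[1, T]]} = X² − T X + N₀`. [folklore] -/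
theorem charpoly_companion (T N₀ : K) : (!![0, -N₀; 1, T] : Matrix (Fin 2) (Fin 2) K).charpoly = X ^ 2 - C T * X + C N₀ := by
  rw [Matrix.charpoly_fin_two, Matrix.trace_fin_two, Matrix.det_fin_two]
  simp

end TwoByTwo

/-! ## §2  `3 × 3`: the Levi block `[[A, 0],[0, c]]` with irreducible `χ_A` is conjugate to `[[C_A, 0],[0, c]]` -/

section ThreeByThree

variable {K : Type*} [Field K]

/-- `[[A,0],[0,c]] · (y ⊕ 1) = (y ⊕ 1) · [[C_A, 0],[0, c]]` for `y = [[1, A₀₀],[0, A₁₀]]`, written in the `leviBlock` coordinates `m = (A₀₀, A₀₁, A₁₀, A₁₁, c)`. [folklore] -/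
theorem leviBlock_mul_cyclicBasis_eq (m : Fin 5 → K) :
    (!![m 0, m 1, 0; m 2, m 3, 0; 0, 0, m 4] : Matrix (Fin 3) (Fin 3) K) * !![1, m 0, 0; 0, m 2, 0; 0, 0, 1] =
      !![1, m 0, 0; 0, m 2, 0; 0, 0, 1] * !![0, -(m 0 * m 3 - m 1 * m 2), 0; 1, m 0 + m 3, 0; 0, 0, m 4] := by
  ext i j
  fin_cases i <;> fin_cases j <;> simp [Matrix.mul_apply, Fin.sum_univ_three] <;> ring

/-- **THE COMPANION NORMAL FORM OF A LEVI BLOCK**: if `χ_{[[m₀,m₁],[m₂,m₃]]}` is irreducible then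
`[[m₀,m₁,0],[m₂,m₃,0],[0,0,m₄]] = y · [[0,−N₀,0],[1,T,0],[0,0,m₄]] · y⁻¹` with `T = m₀ + m₃`, `N₀ = m₀m₃ − m₁m₂` (so `X² − T X + N₀` is that irreducible polynomial).
[cite: PlatonovRapinchuk1994, §3.3] [cite: HarishChandra1970, Part VII §3] -/
theorem exists_leviBlock_eq_conj_companion (m : Fin 5 → K) (hirr : Irreducible (!![m 0, m 1; m 2, m 3] : Matrix (Fin 2) (Fin 2) K).charpoly) :
    ∃ y : GL (Fin 3) K, (!![m 0, m 1, 0; m 2, m 3, 0; 0, 0, m 4] : Matrix (Fin 3) (Fin 3) K) =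
      (y : Matrix (Fin 3) (Fin 3) K) * !![0, -(m 0 * m 3 - m 1 * m 2), 0; 1, m 0 + m 3, 0; 0, 0, m 4] * ((y⁻¹ : GL (Fin 3) K) : Matrix (Fin 3) (Fin 3) K) := by
  have h10 : m 2 ≠ 0 := by simpa using apply_one_zero_ne_zero_of_irreducible _ hirr
  have hdet : (!![1, m 0, 0; 0, m 2, 0; 0, 0, 1] : Matrix (Fin 3) (Fin 3) K).det ≠ 0 := by
    rw [Matrix.det_fin_three]; simpa using h10
  refine ⟨Matrix.GeneralLinearGroup.mkOfDetNeZero _ hdet, ?_⟩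
  rw [Matrix.coe_units_inv]
  show _ = !![1, m 0, 0; 0, m 2, 0; 0, 0, 1] * !![0, -(m 0 * m 3 - m 1 * m 2), 0; 1, m 0 + m 3, 0; 0, 0, m 4] * (!![1, m 0, 0; 0, m 2, 0; 0, 0, 1])⁻¹
  rw [← leviBlock_mul_cyclicBasis_eq, Matrix.mul_nonsing_inv_cancel_right _ _ (by simpa [Matrix.isUnit_iff_isUnit_det, isUnit_iff_ne_zero] using hdet)]

/-- The quadratic factor is recovered from the block: `X² − (m₀+m₃) X + (m₀m₃ − m₁m₂) = χ_{[[m₀,m₁],[m₂,m₃]]}`. [folklore] -/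
theorem charpoly_block_eq (m : Fin 5 → K) :
    (!![m 0, m 1; m 2, m 3] : Matrix (Fin 2) (Fin 2) K).charpoly = X ^ 2 - C (m 0 + m 3) * X + C (m 0 * m 3 - m 1 * m 2) := by
  rw [Matrix.charpoly_fin_two, Matrix.trace_fin_two, Matrix.det_fin_two]
  simp

/-- **REGULAR SEMISIMPLE TRICHOTOMY WITH THE COMPANION MIXED FORM** (any field `K`, `X ∈ 𝔤𝔩₃(K)`, `disc χ_X ≠ 0`): SPLIT `X = y·diagonal d·y⁻¹` (`d` injective) ∕
MIXED `X = y·[[0,−N₀,0],[1,T,0],[0,0,c]]·y⁻¹` with `X² − T X + N₀` IRREDUCIBLE (the companion matrix `C_π` of the quadratic factor `π` of `χ_X`, `c` its rational root) ∕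
ELLIPTIC `χ_X` irreducible (★ (N0) `normalForm_of_discr_ne_zero` + §2). [cite: HarishChandra1970, Part VII §3] [cite: PlatonovRapinchuk1994, §3.3] -/
theorem normalForm_companion_of_discr_ne_zero (X : Matrix (Fin 3) (Fin 3) K) (hD : X.charpoly.discr ≠ 0) :
    (∃ (y : GL (Fin 3) K) (d : Fin 3 → K), Function.Injective d ∧
        X = (y : Matrix (Fin 3) (Fin 3) K) * Matrix.diagonal d * ((y⁻¹ : GL (Fin 3) K) : Matrix (Fin 3) (Fin 3) K)) ∨
      (∃ (y : GL (Fin 3) K) (T N₀ c : K), Irreducible (Polynomial.X ^ 2 - C T * Polynomial.X + C N₀ : K[X]) ∧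
        X = (y : Matrix (Fin 3) (Fin 3) K) * !![0, -N₀, 0; 1, T, 0; 0, 0, c] * ((y⁻¹ : GL (Fin 3) K) : Matrix (Fin 3) (Fin 3) K)) ∨
      Irreducible X.charpoly := by
  rcases K2E3GL3CharpolyDiscNullHaar.normalForm_of_discr_ne_zero X hD with h | ⟨y, m, hirr, hX⟩ | h
  · exact Or.inl h
  · right; left
    obtain ⟨y', hy'⟩ := exists_leviBlock_eq_conj_companion m hirr
    refine ⟨y * y', m 0 + m 3, m 0 * m 3 - m 1 * m 2, m 4, by rw [← charpoly_block_eq]; exact hirr, ?_⟩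
    rw [hX, hy', Units.val_mul, _root_.mul_inv_rev, Units.val_mul]
    simp only [Matrix.mul_assoc]
  · exact Or.inr (Or.inr h)

end ThreeByThree

/-! ## §3  Haar-a.e. on `GL₃(F)` -/

section AE

open Literature.NumberTheory.GaloisRepresentations

variable {F : Type*} [Field F] [ValuativeRel F] [TopologicalSpace F] [IsNonarchimedeanLocalField F]
variable [MeasurableSpace (Matrix (Fin 3) (Fin 3) F)] [BorelSpace (Matrix (Fin 3) (Fin 3) F)]
variable [MeasurableSpace (GL (Fin 3) F)] [BorelSpace (GL (Fin 3) F)]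

/-- **(N0 + companion normal form) Haar-a.e. `g ∈ GL₃(F)` is regular semisimple AND split-diagonalisable ∕ conjugate to `leviBlock(C_π, c)` with `π = X² − TX + N₀`
irreducible ∕ elliptic** — the a.e. case split of the road's ASM in the currency of RULINGS #12 (M12-5). [cite: HarishChandra1970, Part VII §3] -/
theorem ae_discr_ne_zero_and_normalForm_companion (ρ : Measure (GL (Fin 3) F)) [ρ.IsHaarMeasure] :
    ∀ᵐ (g : GL (Fin 3) F) ∂ρ, (g : Matrix (Fin 3) (Fin 3) F).charpoly.discr ≠ 0 ∧
      ((∃ (y : GL (Fin 3) F) (d : Fin 3 → F), Function.Injective d ∧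
          (g : Matrix (Fin 3) (Fin 3) F) = (y : Matrix (Fin 3) (Fin 3) F) * Matrix.diagonal d * ((y⁻¹ : GL (Fin 3) F) : Matrix (Fin 3) (Fin 3) F)) ∨
        (∃ (y : GL (Fin 3) F) (T N₀ c : F), Irreducible (Polynomial.X ^ 2 - C T * Polynomial.X + C N₀ : F[X]) ∧
          (g : Matrix (Fin 3) (Fin 3) F) = (y : Matrix (Fin 3) (Fin 3) F) * !![0, -N₀, 0; 1, T, 0; 0, 0, c] * ((y⁻¹ : GL (Fin 3) F) : Matrix (Fin 3) (Fin 3) F)) ∨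
        Irreducible (g : Matrix (Fin 3) (Fin 3) F).charpoly) := by
  filter_upwards [K2E3GL3CharpolyDiscNullHaar.ae_discr_charpoly_ne_zero ρ] with g hg
  exact ⟨hg, normalForm_companion_of_discr_ne_zero _ hg⟩

end AE

end Summit.HodgeConjecture.HodgeConjecture.Cruxes.H413.K2E3GL3MixedCompanionNormalForm

end
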